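import Summits.BirchSwinnertonDyer.BirchSwinnertonDyer.Theorems.UniversalToricDescentTwinSelfDualMemberRationalInclusionAtThreeTres
import HarnessLib

/-!
# Route `UniversalToricDescent`, B column: ♭B′° 22539 and ♭B′ 27401 BY NAME from K1♯†_T (item 23310's statement ON THE TRÈS-RAMIFIÉ LOCUS) —
# hence from the two-variable road TV₃† — the B column reads K1♯† only where the road delivers it

Cell `bsd-wall`, width seat `bsd-wall-utd-b-w1` (prover g0, 2026-08-29; explicit-unit, operator RE-KEY 00:09Z onto pen pss3x g7's PART 2 item (4));
`--supports stmt-BirchSwinnertonDyer-22539` (helper). Companion of `UniversalToricDescentTwinSelfDualMemberRationalInclusionAtThreeTres` (same seat: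
K1♯†_T := item 23310's text + the très-ramifié binder `¬ 3 ∣ padicValInt 3 W'.minimalDiscriminantInt →` after `Odd (NumberField.discr K) →`;
`tresSelfDual_of_twoVarCoreAtThreeDagger : TV₃† → K1♯†_T`). Theorems only (no definition, no named fact, no `sorry`); standard axioms.

* §4 `twinDegreeFrameAtThreeMultTresT_of_allSplitWtMembersFrames_of_tresSelfDual` — ♭B′° `TwinDegreeFrameAtThreeMultTresT` (22539) BY NAME from the
  weight-controlled consumer-minimal member/frame statement `C_min†` (inline; = hypothesis `hC` of (4)† p662412 VERBATIM) + K1♯†_T, WITHOUT Hsieh Thm B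
  (p680907's reading: the degree clause's own profile hypothesis on `L` is the `μ(L) = 0` input of the self-dual tower).
* §5 `twinDegreeFrameAtThreeMultTresT_of_nonsplitWtMembersFrames_of_twoVarCoreAtThreeDagger` — ♭B′° from {fact† `…_odd_nonsplit_wt` (item 23284) BY NAME,
  TV₃†}: the composition of a two-stub skeleton for 22539 = {`stub_pubMembersFramesCongruence`, `stub_twoVarCoreAtThreeDagger` := TV₃†} (no `stub_thmB`).
* §6 `twinWanFrameAtThreeMultTresT_of_thmB_of_allSplitWtMembersFrames_of_tresSelfDual` / §7 `…_of_thmB_of_nonsplitWtMembersFrames_of_tresSelfDual` —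
  ♭B′ `TwinWanFrameAtThreeMultTresT` (27401) BY NAME from Hsieh Thm B + supply + K1♯†_T ((4)†/(5)† with K1♯† weakened to K1♯†_T): glue† 23330's
  shape `20711 → 23284 → K1♯† → ♭B′` survives a one-binder restatement 23310 ↦ K1♯†_T verbatim (§7 is its closer), after which 23310 is
  closable from a research stub := TV₃† by the companion's §2.

HONEST FRAMING: CONDITIONAL on every displayed hypothesis ({`C_min†`/fact† PUBLISHED reading of [Castella2020JIMJ, Thm. 2.11] + [Skinner2016PacificMC,
§2.6]; Hsieh Thm B PUBLISHED (§6–§7 only); K1♯†_T / TV₃† RESEARCH — no Eisenstein-side engine in print at `p = 3`}); items closed 0; classes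
closed 0; BSD is proved for no curve by this file.

References: [Castella2018Erratum] §2 (p. 2), Thm. 1.1 (iii)(iv), proof (a)(b)(c); [Castella2020JIMJ] Def. 2.10, Thm. 2.11; [Skinner2016PacificMC]
§2.6 (2-6-1), §3.1; [Hsieh2014] Thm. B; [JetchevSkinnerWan2017] §3.4, Cor. 3.4.2, §5.1; [GreenbergVatsal2000] Thm. (1.4).
-/

noncomputable section

open scoped Classical

set_option linter.dupNamespace false
set_option autoImplicit false

namespace Summit.BirchSwinnertonDyer.BirchSwinnertonDyer.Theorems.UniversalToricDescentTwinFramesAtThreeOfTresSelfDual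

open PowerSeries WeierstrassCurve NumberField IsDedekindDomain Field
  Literature.NumberTheory.EllipticCurves
  Literature.NumberTheory.EllipticCurves.ModularForms
  Literature.NumberTheory.EllipticCurves.Rank1Residual
  Literature.NumberTheory.EllipticCurves.BigGaloisRep
  Literature.NumberTheory.EllipticCurves.GreenbergSelmer
  Literature.NumberTheory.GaloisRepresentations
  Summit.BirchSwinnertonDyer.Rank1Residual.X11b
  Summit.BirchSwinnertonDyer.Rank1Residual.X11b.Halves
  Summit.BirchSwinnertonDyer.BirchSwinnertonDyer.Theorems.SchneiderFree
  Summit.BirchSwinnertonDyer.BirchSwinnertonDyer.Theorems.UniversalToricDescentTwinTorsionRankOne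
  Summit.BirchSwinnertonDyer.BirchSwinnertonDyer.Theorems.UniversalToricDescentTwinDecLocus
  Summit.BirchSwinnertonDyer.BirchSwinnertonDyer.Theorems.UniversalToricDescentTwinWanFrameAtThreeMultTresTAllSplitSelfDual
  Summit.BirchSwinnertonDyer.BirchSwinnertonDyer.Theorems.UniversalToricDescentTwinMemberRationalInclusionAtThreeOfTwoVarCoreSelfDual
  Summit.BirchSwinnertonDyer.BirchSwinnertonDyer.Theorems.UniversalToricDescentKernelDegreeOnlyTwin
  Summit.BirchSwinnertonDyer.BirchSwinnertonDyer.Theorems.UniversalToricDescentTwinSelfDualMemberRationalInclusionAtThreeTres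
  Summit.BirchSwinnertonDyer.BirchSwinnertonDyer.Theses.UniversalToricDescent
  Summit.BirchSwinnertonDyer.BirchSwinnertonDyer.Theorems

/-! ### §4 ♭B′° 22539 from `C_min†` + K1♯†_T, without Hsieh Thm B -/

set_option maxHeartbeats 800000 in
-- statement-sized binders over the big representation (as p662412 / p663826); the proof is glue
/-- **♭B′° `TwinDegreeFrameAtThreeMultTresT` (stmt-BirchSwinnertonDyer-22539) BY NAME from the weight-controlled consumer-minimal member/frame
statement `C_min†` over an all-split `K` (inline; (4)†'s `hC` VERBATIM) and K1♯†_T** — no Hsieh Thm B (p680907: the degree clause's own profile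
hypothesis on `L` gives `[Tᵐ]L ∈ R₀ˣ`, i.e. the `μ(L) = 0` input of the self-dual tower), K1♯†_T applied at ♭B′°'s très-ramifié twin.
CONDITIONAL on {`C_min†` PUBLISHED reading, K1♯†_T RESEARCH}; nothing is booked; BSD is proved for no curve.
[cite: Castella2020JIMJ, §2 Def. 2.10, Thm. 2.11] [cite: Skinner2016PacificMC, §2.6 (2-6-1), §3.1 (a)(b) (p. 192)]
[cite: Castella2018Erratum, §2 (p. 2), Thm. 1.1 (iv), proof of Thm. 1.1 (a)(b)(c) (p. 4)] [cite: GreenbergVatsal2000, Thm. (1.4)] -/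
theorem twinDegreeFrameAtThreeMultTresT_of_allSplitWtMembersFrames_of_tresSelfDual
    (hC : ∀ {p : ℕ} [Fact p.Prime] (ι : PadicAlgCl p ≃+* ℂ) (W : WeierstrassCurve ℚ) [W.IsElliptic]
      [W.IsGloballyMinimal] (K : Type) [Field K] [NumberField K]
      (𝔭 : HeightOneSpectrum (𝓞 K)) (κ : ZpExtension K p) (γ : absoluteGaloisGroup K)
      [Fact (κ.IsTopGenerator γ)] {N : ℕ} [NeZero N] {f : CuspForm (CongruenceSubgroup.Gamma0 N) 2}
      (_ : IsNewformOf W f),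
      W.conductorNorm ℤ = N → p ≠ 2 → Mult W p → 3 ≤ N / p → Irr W p →
      IsImaginaryQuadratic K → Odd (NumberField.discr K) → SatisfiesHeegnerHypothesis N K →
      ((Ideal.span {(p : ℤ)}).primesOver (𝓞 K)).ncard = 2 →
      ((p : ℕ) : 𝓞 K) ∈ 𝔭.asIdeal →
      (∀ (w : InfinitePlace K) (x : 𝓞 K), x ∈ 𝔭.asIdeal ↔ ‖ι.symm (w.embedding (x : K))‖ < 1) →
      κ.IsAnticyclotomic →
      ∀ (a : unrIntegers p →+* PadicComplexInt p) (j : ℤ_[p] →+* unrIntegers p),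
        (∀ x : unrIntegers p, ((a x : PadicComplexInt p) : ℂ_[p]) = (x : ℂ_[p])) →
        (∀ x : ℤ_[p], ((j x : unrIntegers p) : ℂ_[p]) = algebraMap ℚ_[p] ℂ_[p] (x : ℚ_[p])) →
      ∃ (ΩK : ℂ) (Ωp : (unrIntegers p)ˣ) (L : UnrSeries p),
        ΩK ≠ 0 ∧ IsBDPLFunction ι 𝔭 κ γ f ΩK ((Ωp : unrIntegers p) : ℂ_[p]) L ∧
        ∀ m : ℕ, 1 ≤ m →
          ∃ (D : Skinner2016.HidaCongruentMember W p m) (Qm : PowerSeries (PadicComplexInt p)),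
            (2 * ((p : ℤ) - 1) * (p : ℤ) ^ (m - 1)) ∣ D.k - 2 ∧
            (∀ x : coeffField D.g, ι (D.ι x) = (x : ℂ)) ∧
            SkinnerUrban2014.IsResiduallyIrreducible D.Δ ∧
            IsBDPLFunctionWtSigmaInt ι 𝔭 κ γ D.g (W.sigmaPlacesFinset p K) ΩK ((Ωp : unrIntegers p) : ℂ_[p]) Qm ∧
            Ideal.span {Qm} ⊔ Ideal.span {(PowerSeries.C (((p : ℕ) : PadicComplexInt p) ^ m))} =
              Ideal.span {PowerSeries.map a (L * PowerSeries.map j (W.sigmaEulerElement p K κ))} ⊔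
                Ideal.span {(PowerSeries.C (((p : ℕ) : PadicComplexInt p) ^ m))})
    (hT :
    ∀ (W' : WeierstrassCurve ℚ) [W'.IsElliptic] [W'.IsGloballyMinimal] (N' : ℕ) [NeZero N']
      (K : Type) [Field K] [NumberField K] (Dt' : ModularParametrizationData W' N'),
      Mult W' 3 → W'.HasSurjectiveModNGaloisRep 3 → W'.conductorNorm ℤ = N' → IsImaginaryQuadratic K →
      SatisfiesHeegnerHypothesis N' K → Odd (NumberField.discr K) → ¬ 3 ∣ padicValInt 3 W'.minimalDiscriminantInt →
      ∀ (κ : ZpExtension K 3), κ.IsAnticyclotomic → ∀ (γ : absoluteGaloisGroup K) [Fact (κ.IsTopGenerator γ)]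
        (𝔭 : HeightOneSpectrum (𝓞 K)), ((3 : ℕ) : 𝓞 K) ∈ 𝔭.asIdeal →
        𝔭.asIdeal.ramificationIdx (𝓞 ℚ) = 1 → 𝔭.asIdeal.inertiaDeg (𝓞 ℚ) = 1 →
        ∀ (𝔭' : HeightOneSpectrum (𝓞 K)), ((3 : ℕ) : 𝓞 K) ∈ 𝔭'.asIdeal → 𝔭' ≠ 𝔭 →
        ∀ (ι' : PadicAlgCl 3 ≃+* ℂ), BranchInducesPrime 3 ι' 𝔭 →
        ∀ (m : ℕ), 1 ≤ m → ∀ (D : Skinner2016.HidaCongruentMember W' 3 m),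
          (2 * (((3 : ℕ) : ℤ) - 1) * ((3 : ℕ) : ℤ) ^ (m - 1)) ∣ D.k - 2 →
          SkinnerUrban2014.IsResiduallyIrreducible D.Δ →
          (∀ x : coeffField D.g, ι' (D.ι x) = (x : ℂ)) →
        ∀ (b : padicCoeffIntegers D.ι →+* 𝓞_ℂ_[3]),
          (∀ x, ((b x : 𝓞_ℂ_[3]) : ℂ_[3]) = algebraMap (PadicAlgCl 3) ℂ_[3] (padicCoeffIntegers.toPadicAlgCl D.ι x)) →
        ∀ (ΩK : ℂ) (Ωp : (𝓞_ℂ_[3])ˣ) (Q : PowerSeries 𝓞_ℂ_[3]), ΩK ≠ 0 →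
          IsBDPLFunctionWtSigmaInt ι' 𝔭 κ γ D.g (W'.sigmaPlacesFinset 3 K) ΩK ((Ωp : 𝓞_ℂ_[3]) : ℂ_[3]) Q →
        ∀ [TopologicalSpace (PowerSeries (padicCoeffIntegers D.ι))]
          [ContinuousSMul (PowerSeries (padicCoeffIntegers D.ι))
            (BigRepModule (padicCoeffIntegers D.ι) 3 (Cofree D.Δ.selfDualRep (padicCoeffField D.ι)))],
          Module.IsTorsion (PowerSeries (padicCoeffIntegers D.ι))
              (XBig κ (D.Δ.selfDualCofreeRepOver K) 𝔭' (↑(W'.sigmaPlacesFinset 3 K))) →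
            ∃ e : ℕ, Ideal.span {(PowerSeries.C ((3 : ℕ) : 𝓞_ℂ_[3]) : PowerSeries 𝓞_ℂ_[3]) ^ e} *
                (XBig.charIdeal κ (D.Δ.selfDualCofreeRepOver K) 𝔭' (↑(W'.sigmaPlacesFinset 3 K))).map (PowerSeries.map b) ≤
              Ideal.span {Q}) :
    TwinDegreeFrameAtThreeMultTresT := by
  intro W' _ _ N' _ K _ _ Dt' hmult hsurj hN' hK hH hodd hndvd κ hκ γ _ 𝔭 h𝔭 he hf 𝔭' h𝔭' hne ι' hι'
  -- (dec) from the très-ramifié binder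
  have hdec : ∀ Q : (W'.baseChange ℚ_[3]).toAffine.Point, 3 • Q = 0 → Q = 0 :=
    twin_dec_of_forall_not_cube W' hmult (forall_not_exists_pow_of_nonsplit_or_not_dvd W' (Or.inr hndvd))
  have hirr : Irr W' 3 := hasIrreducibleModPGaloisRep_of_hasSurjectiveModNGaloisRep W' 3 hsurj
  have hM : 3 ≤ N' / 3 := by
    have h11 := Pasten2024.eleven_le_level Dt'
    omega
  have hsplit : ((Ideal.span {((3 : ℕ) : ℤ)}).primesOver (𝓞 K)).ncard = 2 :=
    ncard_primesOver_eq_two_of_degreeOne hK.1 h𝔭 he hf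
  obtain ⟨ΩK, Ωp, L, hΩK, hL, hmem⟩ := hC ι' W' K 𝔭 κ γ Dt'.isNewformOf hN' (by decide) hmult hM hirr hK hodd hH hsplit h𝔭 hι'
    hκ (R1.unrToCpInt 3) (toUnr 3) (R1.coe_unrToCpInt 3) (coe_toUnr 3)
  have hΩp' : (((Units.map (R1.unrToCpInt 3 : unrIntegers 3 →* 𝓞_ℂ_[3]) Ωp : (𝓞_ℂ_[3])ˣ) : 𝓞_ℂ_[3]) : ℂ_[3]) =
      ((Ωp : unrIntegers 3) : ℂ_[3]) := by
    rw [Units.coe_map, MonoidHom.coe_coe, R1.coe_unrToCpInt]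
  have hΩp0 : ((Ωp : unrIntegers 3) : ℂ_[3]) ≠ 0 := fun h0 ↦
    Ωp.ne_zero ((ZeroMemClass.coe_eq_zero).mp h0)
  refine ⟨ΩK, ((Ωp : unrIntegers 3) : ℂ_[3]), L, hΩK, hΩp0, hL, fun hT₀ g n m hg hprof hprofL ↦ ?_⟩
  -- `μ(L) = 0` is the clause's OWN hypothesis
  have hμL : ∃ i : ℕ, IsUnit (PowerSeries.coeff i L) :=
    ⟨m, (unrIntegers.isUnit_iff_norm_eq_one _).mpr hprofL.2⟩
  have hwan : ∃ k : ℕ, ∀ G ∈ (AcSelmer.XAc.charIdeal (W'.baseChange K) 3 κ 𝔭' ∅ γ).map (PowerSeries.map (toUnr 3)),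
      PowerSeries.C (((3 : ℕ) : unrIntegers 3) ^ k) * G ∈ Ideal.span {L} := by
    refine twin_exists_forall_C_pow_mul_mem_span_of_cpIntMemberTower_selfDual_of_isTorsion
      SkinnerUrban2014.prop323_XAc_equiv_XBigDecomp_holds W' N' K hmult hsurj hN' hK hH κ hκ γ 𝔭' h𝔭' hdec hT₀ L hμL
      fun m hm ↦ ?_
    exact (hmem m hm).elim fun D hD ↦ hD.elim fun Qm hQ ↦
      ⟨D, Qm, hQ.1, fun b hb hT' ↦ hT W' N' K Dt' hmult hsurj hN' hK hH hodd hndvd κ hκ γ 𝔭 h𝔭 he hf 𝔭' h𝔭' hne ι' hι' m hm D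
        hQ.1 hQ.2.2.1 hQ.2.1 b hb
        ΩK (Units.map (R1.unrToCpInt 3 : unrIntegers 3 →* 𝓞_ℂ_[3]) Ωp) Qm hΩK (hΩp' ▸ hQ.2.2.2.1) hT', hQ.2.2.2.2⟩
  exact degreeClause_of_wanClause hwan g n m hg hprof hprofL

/-! ### §5 ♭B′° 22539 from the supply fact† and TV₃† — the composition of a two-stub skeleton with research stub := TV₃† -/

set_option maxHeartbeats 800000 in
-- statement-sized binders over the big representation (as p662412 / p663826); the proof is glue
/-- **♭B′° `TwinDegreeFrameAtThreeMultTresT` (22539) BY NAME from `Castella2018.castella2020_thm211_members_frames_sigma_congruence_odd_nonsplit_wt`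
(item 23284 = `stub_pubMembersFramesCongruence`) and TV₃†** — §4 ∘ `allSplitWtMembersFrames_of_nonsplitWtMembersFrames` ∘ §2; no Hsieh Thm B. The
composition of a skeleton for 22539 with stubs {`stub_pubMembersFramesCongruence`, `stub_twoVarCoreAtThreeDagger` := TV₃†}. CONDITIONAL on
{PUBLISHED reading, TV₃† RESEARCH}; nothing is booked; BSD is proved for no curve. [cite: Castella2020JIMJ, §2 Thm. 2.11]
[cite: JetchevSkinnerWan2017, §3.4, Cor. 3.4.2] [cite: Castella2018Erratum, §2 (p. 2), proof of Thm. 1.1 (a)(b)(c)] -/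
theorem twinDegreeFrameAtThreeMultTresT_of_nonsplitWtMembersFrames_of_twoVarCoreAtThreeDagger
    (hC' : Castella2018.castella2020_thm211_members_frames_sigma_congruence_odd_nonsplit_wt)
    (hTV :
    ∀ (W' : WeierstrassCurve ℚ) [W'.IsElliptic] [W'.IsGloballyMinimal] (N' : ℕ) [NeZero N']
      (K : Type) [Field K] [NumberField K] (Dt' : ModularParametrizationData W' N'),
      Mult W' 3 → W'.HasSurjectiveModNGaloisRep 3 → W'.conductorNorm ℤ = N' → IsImaginaryQuadratic K →
      SatisfiesHeegnerHypothesis N' K → Odd (NumberField.discr K) →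
      ∀ (κ : ZpExtension K 3), κ.IsAnticyclotomic → ∀ (γ : absoluteGaloisGroup K) [Fact (κ.IsTopGenerator γ)]
        (𝔭 : HeightOneSpectrum (𝓞 K)), ((3 : ℕ) : 𝓞 K) ∈ 𝔭.asIdeal →
        𝔭.asIdeal.ramificationIdx (𝓞 ℚ) = 1 → 𝔭.asIdeal.inertiaDeg (𝓞 ℚ) = 1 →
        ∀ (𝔭' : HeightOneSpectrum (𝓞 K)), ((3 : ℕ) : 𝓞 K) ∈ 𝔭'.asIdeal → 𝔭' ≠ 𝔭 →
        ∀ (ι' : PadicAlgCl 3 ≃+* ℂ), BranchInducesPrime 3 ι' 𝔭 →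
        ∀ (m : ℕ), 1 ≤ m → ∀ (D : Skinner2016.HidaCongruentMember W' 3 m),
          (2 * (((3 : ℕ) : ℤ) - 1) * ((3 : ℕ) : ℤ) ^ (m - 1)) ∣ D.k - 2 →
          SkinnerUrban2014.IsResiduallyIrreducible D.Δ →
          (∀ a : Cofree D.Δ.selfDualRep (padicCoeffField D.ι),
              (∀ σ : LocalGroup K (Sum.inl 𝔭'), (D.Δ.selfDualCofreeRepOver K) (localMap K (Sum.inl 𝔭') σ) a = a) →
              (∃ j : ℕ, (3 : ℕ) ^ j • a = 0) → a = 0) →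
          (∀ x : coeffField D.g, ι' (D.ι x) = (x : ℂ)) →
        ∀ (b : padicCoeffIntegers D.ι →+* 𝓞_ℂ_[3]),
          (∀ x, ((b x : 𝓞_ℂ_[3]) : ℂ_[3]) = algebraMap (PadicAlgCl 3) ℂ_[3] (padicCoeffIntegers.toPadicAlgCl D.ι x)) →
        ∀ (ΩK : ℂ) (Ωp : (𝓞_ℂ_[3])ˣ) (Q : PowerSeries 𝓞_ℂ_[3]), ΩK ≠ 0 →
          IsBDPLFunctionWtSigmaInt ι' 𝔭 κ γ D.g (W'.sigmaPlacesFinset 3 K) ΩK ((Ωp : 𝓞_ℂ_[3]) : ℂ_[3]) Q →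
        ∀ (κ' : ZpExtension K 3) (γ' : absoluteGaloisGroup K) [Fact (κ'.IsTopGenerator γ')], κ'.IsCyclotomic →
        ∀ [TopologicalSpace (PowerSeries (padicCoeffIntegers D.ι))]
          [TopologicalSpace (PowerSeries (PowerSeries (padicCoeffIntegers D.ι)))]
          [ContinuousSMul (PowerSeries (PowerSeries (padicCoeffIntegers D.ι)))
            (BigRepModule (PowerSeries (padicCoeffIntegers D.ι)) 3
              (BigRepModule (padicCoeffIntegers D.ι) 3 (Cofree D.Δ.selfDualRep (padicCoeffField D.ι))))],
          Module.IsTorsion (PowerSeries (PowerSeries (padicCoeffIntegers D.ι)))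
              (XBig κ' (AnticyclotomicBigGaloisRep κ (D.Δ.selfDualCofreeRepOver K)) 𝔭' (↑(W'.sigmaPlacesFinset 3 K))) →
            ∃ Q₂ : PowerSeries (PowerSeries 𝓞_ℂ_[3]),
              (∃ u : (PowerSeries 𝓞_ℂ_[3])ˣ, PowerSeries.constantCoeff Q₂ = (u : PowerSeries 𝓞_ℂ_[3]) * Q) ∧
              (XBig.charIdeal κ' (AnticyclotomicBigGaloisRep κ (D.Δ.selfDualCofreeRepOver K)) 𝔭'
                  (↑(W'.sigmaPlacesFinset 3 K))).map (PowerSeries.map (PowerSeries.map b)) ≤ Ideal.span {Q₂}) :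
    TwinDegreeFrameAtThreeMultTresT :=
  twinDegreeFrameAtThreeMultTresT_of_allSplitWtMembersFrames_of_tresSelfDual
    (allSplitWtMembersFrames_of_nonsplitWtMembersFrames hC') (tresSelfDual_of_twoVarCoreAtThreeDagger hTV)

/-! ### §6–§7 ♭B′ 27401 from Hsieh Thm B + supply + K1♯†_T: the B column reads K1♯† only on the très-ramifié locus -/

set_option maxHeartbeats 800000 in
-- statement-sized binders over the big representation (as p662412 / p663826); the proof is glue
/-- **♭B′ `TwinWanFrameAtThreeMultTresT` (stmt-BirchSwinnertonDyer-27401) BY NAME from Hsieh Thm B + `C_min†` (inline) + K1♯†_T** — (4)†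
`twinWanFrameAtThreeMultTresT_of_thmB_of_allSplitWtMembersFrames_of_selfDualMemberRationalInclusion` with its hypothesis K1♯† WEAKENED to K1♯†_T
(applied at ♭B′'s très-ramifié twin; same proof). CONDITIONAL on {Hsieh Thm B PUBLISHED, `C_min†` PUBLISHED reading, K1♯†_T RESEARCH}; nothing is
booked; BSD is proved for no curve. [cite: Hsieh2014, Thm. B p. 712] [cite: Castella2020JIMJ, §2 Def. 2.10, Thm. 2.11]
[cite: Skinner2016PacificMC, §2.6 (2-6-1), §3.1 (a)(b) (p. 192)] [cite: Castella2018Erratum, §2 (p. 2), Thm. 1.1 (iv), proof of Thm. 1.1 (a)(b)(c) (p. 4)] -/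
theorem twinWanFrameAtThreeMultTresT_of_thmB_of_allSplitWtMembersFrames_of_tresSelfDual
    (hB : Hsieh2014.thmB_exists_isHsiehLFunction_coeff_norm_eq_one_unrPeriod_anyLevel)
    (hC : ∀ {p : ℕ} [Fact p.Prime] (ι : PadicAlgCl p ≃+* ℂ) (W : WeierstrassCurve ℚ) [W.IsElliptic]
      [W.IsGloballyMinimal] (K : Type) [Field K] [NumberField K]
      (𝔭 : HeightOneSpectrum (𝓞 K)) (κ : ZpExtension K p) (γ : absoluteGaloisGroup K)
      [Fact (κ.IsTopGenerator γ)] {N : ℕ} [NeZero N] {f : CuspForm (CongruenceSubgroup.Gamma0 N) 2}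
      (_ : IsNewformOf W f),
      W.conductorNorm ℤ = N → p ≠ 2 → Mult W p → 3 ≤ N / p → Irr W p →
      IsImaginaryQuadratic K → Odd (NumberField.discr K) → SatisfiesHeegnerHypothesis N K →
      ((Ideal.span {(p : ℤ)}).primesOver (𝓞 K)).ncard = 2 →
      ((p : ℕ) : 𝓞 K) ∈ 𝔭.asIdeal →
      (∀ (w : InfinitePlace K) (x : 𝓞 K), x ∈ 𝔭.asIdeal ↔ ‖ι.symm (w.embedding (x : K))‖ < 1) →
      κ.IsAnticyclotomic →
      ∀ (a : unrIntegers p →+* PadicComplexInt p) (j : ℤ_[p] →+* unrIntegers p),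
        (∀ x : unrIntegers p, ((a x : PadicComplexInt p) : ℂ_[p]) = (x : ℂ_[p])) →
        (∀ x : ℤ_[p], ((j x : unrIntegers p) : ℂ_[p]) = algebraMap ℚ_[p] ℂ_[p] (x : ℚ_[p])) →
      ∃ (ΩK : ℂ) (Ωp : (unrIntegers p)ˣ) (L : UnrSeries p),
        ΩK ≠ 0 ∧ IsBDPLFunction ι 𝔭 κ γ f ΩK ((Ωp : unrIntegers p) : ℂ_[p]) L ∧
        ∀ m : ℕ, 1 ≤ m →
          ∃ (D : Skinner2016.HidaCongruentMember W p m) (Qm : PowerSeries (PadicComplexInt p)),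
            (2 * ((p : ℤ) - 1) * (p : ℤ) ^ (m - 1)) ∣ D.k - 2 ∧
            (∀ x : coeffField D.g, ι (D.ι x) = (x : ℂ)) ∧
            SkinnerUrban2014.IsResiduallyIrreducible D.Δ ∧
            IsBDPLFunctionWtSigmaInt ι 𝔭 κ γ D.g (W.sigmaPlacesFinset p K) ΩK ((Ωp : unrIntegers p) : ℂ_[p]) Qm ∧
            Ideal.span {Qm} ⊔ Ideal.span {(PowerSeries.C (((p : ℕ) : PadicComplexInt p) ^ m))} =
              Ideal.span {PowerSeries.map a (L * PowerSeries.map j (W.sigmaEulerElement p K κ))} ⊔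
                Ideal.span {(PowerSeries.C (((p : ℕ) : PadicComplexInt p) ^ m))})
    (hT :
    ∀ (W' : WeierstrassCurve ℚ) [W'.IsElliptic] [W'.IsGloballyMinimal] (N' : ℕ) [NeZero N']
      (K : Type) [Field K] [NumberField K] (Dt' : ModularParametrizationData W' N'),
      Mult W' 3 → W'.HasSurjectiveModNGaloisRep 3 → W'.conductorNorm ℤ = N' → IsImaginaryQuadratic K →
      SatisfiesHeegnerHypothesis N' K → Odd (NumberField.discr K) → ¬ 3 ∣ padicValInt 3 W'.minimalDiscriminantInt →
      ∀ (κ : ZpExtension K 3), κ.IsAnticyclotomic → ∀ (γ : absoluteGaloisGroup K) [Fact (κ.IsTopGenerator γ)]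
        (𝔭 : HeightOneSpectrum (𝓞 K)), ((3 : ℕ) : 𝓞 K) ∈ 𝔭.asIdeal →
        𝔭.asIdeal.ramificationIdx (𝓞 ℚ) = 1 → 𝔭.asIdeal.inertiaDeg (𝓞 ℚ) = 1 →
        ∀ (𝔭' : HeightOneSpectrum (𝓞 K)), ((3 : ℕ) : 𝓞 K) ∈ 𝔭'.asIdeal → 𝔭' ≠ 𝔭 →
        ∀ (ι' : PadicAlgCl 3 ≃+* ℂ), BranchInducesPrime 3 ι' 𝔭 →
        ∀ (m : ℕ), 1 ≤ m → ∀ (D : Skinner2016.HidaCongruentMember W' 3 m),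
          (2 * (((3 : ℕ) : ℤ) - 1) * ((3 : ℕ) : ℤ) ^ (m - 1)) ∣ D.k - 2 →
          SkinnerUrban2014.IsResiduallyIrreducible D.Δ →
          (∀ x : coeffField D.g, ι' (D.ι x) = (x : ℂ)) →
        ∀ (b : padicCoeffIntegers D.ι →+* 𝓞_ℂ_[3]),
          (∀ x, ((b x : 𝓞_ℂ_[3]) : ℂ_[3]) = algebraMap (PadicAlgCl 3) ℂ_[3] (padicCoeffIntegers.toPadicAlgCl D.ι x)) →
        ∀ (ΩK : ℂ) (Ωp : (𝓞_ℂ_[3])ˣ) (Q : PowerSeries 𝓞_ℂ_[3]), ΩK ≠ 0 →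
          IsBDPLFunctionWtSigmaInt ι' 𝔭 κ γ D.g (W'.sigmaPlacesFinset 3 K) ΩK ((Ωp : 𝓞_ℂ_[3]) : ℂ_[3]) Q →
        ∀ [TopologicalSpace (PowerSeries (padicCoeffIntegers D.ι))]
          [ContinuousSMul (PowerSeries (padicCoeffIntegers D.ι))
            (BigRepModule (padicCoeffIntegers D.ι) 3 (Cofree D.Δ.selfDualRep (padicCoeffField D.ι)))],
          Module.IsTorsion (PowerSeries (padicCoeffIntegers D.ι))
              (XBig κ (D.Δ.selfDualCofreeRepOver K) 𝔭' (↑(W'.sigmaPlacesFinset 3 K))) →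
            ∃ e : ℕ, Ideal.span {(PowerSeries.C ((3 : ℕ) : 𝓞_ℂ_[3]) : PowerSeries 𝓞_ℂ_[3]) ^ e} *
                (XBig.charIdeal κ (D.Δ.selfDualCofreeRepOver K) 𝔭' (↑(W'.sigmaPlacesFinset 3 K))).map (PowerSeries.map b) ≤
              Ideal.span {Q}) :
    TwinWanFrameAtThreeMultTresT := by
  intro W' _ _ N' _ K _ _ Dt' hmult hsurj hN' hK hH hodd hndvd κ hκ γ _ 𝔭 h𝔭 he hf 𝔭' h𝔭' hne ι' hι'
  have hdec : ∀ Q : (W'.baseChange ℚ_[3]).toAffine.Point, 3 • Q = 0 → Q = 0 :=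
    twin_dec_of_forall_not_cube W' hmult (forall_not_exists_pow_of_nonsplit_or_not_dvd W' (Or.inr hndvd))
  have hirr : Irr W' 3 := hasIrreducibleModPGaloisRep_of_hasSurjectiveModNGaloisRep W' 3 hsurj
  have hM : 3 ≤ N' / 3 := by
    have h11 := Pasten2024.eleven_le_level Dt'
    omega
  have hsplit : ((Ideal.span {((3 : ℕ) : ℤ)}).primesOver (𝓞 K)).ncard = 2 :=
    ncard_primesOver_eq_two_of_degreeOne hK.1 h𝔭 he hf
  obtain ⟨ΩK, Ωp, L, hΩK, hL, hmem⟩ := hC ι' W' K 𝔭 κ γ Dt'.isNewformOf hN' (by decide) hmult hM hirr hK hodd hH hsplit h𝔭 hι'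
    hκ (R1.unrToCpInt 3) (toUnr 3) (R1.coe_unrToCpInt 3) (coe_toUnr 3)
  have hΩp' : (((Units.map (R1.unrToCpInt 3 : unrIntegers 3 →* 𝓞_ℂ_[3]) Ωp : (𝓞_ℂ_[3])ˣ) : 𝓞_ℂ_[3]) : ℂ_[3]) =
      ((Ωp : unrIntegers 3) : ℂ_[3]) := by
    rw [Units.coe_map, MonoidHom.coe_coe, R1.coe_unrToCpInt]
  have hΩp0 : ((Ωp : unrIntegers 3) : ℂ_[3]) ≠ 0 := fun h0 ↦
    Ωp.ne_zero ((ZeroMemClass.coe_eq_zero).mp h0)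
  -- `μ(L) = 0` from Thm B (♭-witness moved across periods), as in (4)†
  have hμL : ∃ i : ℕ, IsUnit (PowerSeries.coeff i L) := by
    obtain ⟨ΩK₁, Ωp₁, Q, hΩK₁, hΩp₁, hQ, hμQ⟩ :=
      Summit.BirchSwinnertonDyer.BirchSwinnertonDyer.Theorems.UniversalToricDescentSelfMuZero.self_exists_isBDPLFunctionInt_coeff_norm_eq_one
        hB W' N' K Dt' hsurj hK hH κ hκ γ 𝔭 h𝔭 he hf ι' hι'
    have hΩp₁0 : Ωp₁ ≠ 0 := fun h ↦ by rw [h, norm_zero] at hΩp₁; exact zero_ne_one hΩp₁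
    obtain ⟨i, hi⟩ :=
      Summit.BirchSwinnertonDyer.BirchSwinnertonDyer.Theorems.UniversalToricDescentFlatMuTransfer.exists_coeff_norm_eq_one_of_isBDPLFunctionInt_of_isBDPLFunction
        hK hκ Fact.out hΩK₁ hΩK hΩp₁0 hΩp0 hQ hL hμQ
    exact ⟨i, (unrIntegers.isUnit_iff_norm_eq_one _).mpr hi⟩
  refine ⟨ΩK, ((Ωp : unrIntegers 3) : ℂ_[3]), L, hΩK, hΩp0, hL, fun hT₀ ↦ ?_⟩
  refine twin_exists_forall_C_pow_mul_mem_span_of_cpIntMemberTower_selfDual_of_isTorsion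
    SkinnerUrban2014.prop323_XAc_equiv_XBigDecomp_holds W' N' K hmult hsurj hN' hK hH κ hκ γ 𝔭' h𝔭' hdec hT₀ L hμL
    fun m hm ↦ ?_
  exact (hmem m hm).elim fun D hD ↦ hD.elim fun Qm hQ ↦
    ⟨D, Qm, hQ.1, fun b hb hT' ↦ hT W' N' K Dt' hmult hsurj hN' hK hH hodd hndvd κ hκ γ 𝔭 h𝔭 he hf 𝔭' h𝔭' hne ι' hι' m hm D
      hQ.1 hQ.2.2.1 hQ.2.1 b hb
      ΩK (Units.map (R1.unrToCpInt 3 : unrIntegers 3 →* 𝓞_ℂ_[3]) Ωp) Qm hΩK (hΩp' ▸ hQ.2.2.2.1) hT', hQ.2.2.2.2⟩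

set_option maxHeartbeats 800000 in
-- statement-sized binders over the big representation (as p662412 / p663826); the proof is glue
/-- **♭B′ `TwinWanFrameAtThreeMultTresT` (27401) BY NAME from Hsieh Thm B (20711), the supply fact† (23284) and K1♯†_T** — §6 ∘
`allSplitWtMembersFrames_of_nonsplitWtMembersFrames`: glue† 23330's shape `20711 → 23284 → K1♯† → ♭B′` survives the one-binder restatement
K1♯† ↦ K1♯†_T verbatim. CONDITIONAL on {PUBLISHED, PUBLISHED reading, K1♯†_T RESEARCH}; nothing is booked; BSD is proved for no curve.
[cite: Hsieh2014, Thm. B p. 712] [cite: Castella2020JIMJ, §2 Thm. 2.11] [cite: Castella2018Erratum, §2 (p. 2), proof of Thm. 1.1 (a)(b)(c)] -/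
theorem twinWanFrameAtThreeMultTresT_of_thmB_of_nonsplitWtMembersFrames_of_tresSelfDual
    (hB : Hsieh2014.thmB_exists_isHsiehLFunction_coeff_norm_eq_one_unrPeriod_anyLevel)
    (hC' : Castella2018.castella2020_thm211_members_frames_sigma_congruence_odd_nonsplit_wt)
    (hT :
    ∀ (W' : WeierstrassCurve ℚ) [W'.IsElliptic] [W'.IsGloballyMinimal] (N' : ℕ) [NeZero N']
      (K : Type) [Field K] [NumberField K] (Dt' : ModularParametrizationData W' N'),
      Mult W' 3 → W'.HasSurjectiveModNGaloisRep 3 → W'.conductorNorm ℤ = N' → IsImaginaryQuadratic K →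
      SatisfiesHeegnerHypothesis N' K → Odd (NumberField.discr K) → ¬ 3 ∣ padicValInt 3 W'.minimalDiscriminantInt →
      ∀ (κ : ZpExtension K 3), κ.IsAnticyclotomic → ∀ (γ : absoluteGaloisGroup K) [Fact (κ.IsTopGenerator γ)]
        (𝔭 : HeightOneSpectrum (𝓞 K)), ((3 : ℕ) : 𝓞 K) ∈ 𝔭.asIdeal →
        𝔭.asIdeal.ramificationIdx (𝓞 ℚ) = 1 → 𝔭.asIdeal.inertiaDeg (𝓞 ℚ) = 1 →
        ∀ (𝔭' : HeightOneSpectrum (𝓞 K)), ((3 : ℕ) : 𝓞 K) ∈ 𝔭'.asIdeal → 𝔭' ≠ 𝔭 →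
        ∀ (ι' : PadicAlgCl 3 ≃+* ℂ), BranchInducesPrime 3 ι' 𝔭 →
        ∀ (m : ℕ), 1 ≤ m → ∀ (D : Skinner2016.HidaCongruentMember W' 3 m),
          (2 * (((3 : ℕ) : ℤ) - 1) * ((3 : ℕ) : ℤ) ^ (m - 1)) ∣ D.k - 2 →
          SkinnerUrban2014.IsResiduallyIrreducible D.Δ →
          (∀ x : coeffField D.g, ι' (D.ι x) = (x : ℂ)) →
        ∀ (b : padicCoeffIntegers D.ι →+* 𝓞_ℂ_[3]),
          (∀ x, ((b x : 𝓞_ℂ_[3]) : ℂ_[3]) = algebraMap (PadicAlgCl 3) ℂ_[3] (padicCoeffIntegers.toPadicAlgCl D.ι x)) →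
        ∀ (ΩK : ℂ) (Ωp : (𝓞_ℂ_[3])ˣ) (Q : PowerSeries 𝓞_ℂ_[3]), ΩK ≠ 0 →
          IsBDPLFunctionWtSigmaInt ι' 𝔭 κ γ D.g (W'.sigmaPlacesFinset 3 K) ΩK ((Ωp : 𝓞_ℂ_[3]) : ℂ_[3]) Q →
        ∀ [TopologicalSpace (PowerSeries (padicCoeffIntegers D.ι))]
          [ContinuousSMul (PowerSeries (padicCoeffIntegers D.ι))
            (BigRepModule (padicCoeffIntegers D.ι) 3 (Cofree D.Δ.selfDualRep (padicCoeffField D.ι)))],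
          Module.IsTorsion (PowerSeries (padicCoeffIntegers D.ι))
              (XBig κ (D.Δ.selfDualCofreeRepOver K) 𝔭' (↑(W'.sigmaPlacesFinset 3 K))) →
            ∃ e : ℕ, Ideal.span {(PowerSeries.C ((3 : ℕ) : 𝓞_ℂ_[3]) : PowerSeries 𝓞_ℂ_[3]) ^ e} *
                (XBig.charIdeal κ (D.Δ.selfDualCofreeRepOver K) 𝔭' (↑(W'.sigmaPlacesFinset 3 K))).map (PowerSeries.map b) ≤
              Ideal.span {Q}) :
    TwinWanFrameAtThreeMultTresT :=
  twinWanFrameAtThreeMultTresT_of_thmB_of_allSplitWtMembersFrames_of_tresSelfDual hB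
    (allSplitWtMembersFrames_of_nonsplitWtMembersFrames hC') hT

end Summit.BirchSwinnertonDyer.BirchSwinnertonDyer.Theorems.UniversalToricDescentTwinFramesAtThreeOfTresSelfDual

end
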